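import Mathlib.Analysis.Normed.Module.Basic
import Mathlib.Algebra.BigOperators.NatAntidiagonal
import Mathlib.Data.Nat.Choose.Sum
import HarnessLib

/-!
# `RigorousRGSmallParameter` (Slade, Theorem 1.4.1): the `T_φ` seminorm of [BS-rg-norm] —
# I. The semi-normed algebra `(𝓕, ⋆, ‖·‖_T)` and its product property (Brydges–Slade, Prop. 5.1.2)

Companion ("proof architecture") file of
`Literature/Barriers/CriticalPhenomena/RigorousRGSmallParameter.lean`. The tree reduces that
barrier (Slade's Theorem 1.4.1) to the named fact `LongRangePhi4.Slade2017_prop822`, the output of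
the renormalisation-group flow, whose single-step input is Slade's Theorem 6.3.1 — the
renormalisation-group map with estimates in the `T_φ`, `Φ_j(𝔥_j)` and `𝒲_j` norms of his §6.2,
which "recall[s] the definitions of several norms from [BS-rg-norm, BS-rg-step]". This file and its
two sequels (`…TphiCalculus.lean`, `…TestFunctionNorm.lean`) formalise the first of these objects,
the `T_φ` seminorm, together with its fundamental **product property**
`‖FG‖_{T_φ} ≤ ‖F‖_{T_φ}‖G‖_{T_φ}` (Brydges–Slade, Proposition 3.4.5: "The `T_φ` semi-norm has
several attractive and useful properties. The most fundamental of these is the product property"),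
for the field content of Slade's model with `n ≥ 1`: ONE real boson species with `n` components
and no fermion field (so `𝚲 = Λ × {1,…,n}`, sequences carry no signs and `z! = p!` for a sequence
of length `p`, as in Slade's §6.2.2).

Sources. D.C. Brydges, G. Slade, *A renormalisation group method. I. Gaussian integration and
normed algebras*, J. Stat. Phys. **159** (2015) 421–460, arXiv:1403.7244 [BS-rg-norm]
(held; read from the TeX source: Definition 3.3.1, Example 3.3.2, Definition 3.4.1,
Proposition 3.4.5, and §5.1 "Proof of the product property" with Lemma 5.1.1 and
Proposition 5.1.2); G. Slade, Commun. Math. Phys. **358** (2018) 343–436, arXiv:1611.06169, §6.2.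

## The printed proof (BS-rg-norm §5.1) and what this file does

The product property is proved in [BS-rg-norm] "by first establishing the product property for a
more general algebra with semi-norm, and then noting that the product property of the `T_φ` norm
follows as an instance": the algebra `𝓕` of coefficient families `(F_z)_{z ∈ 𝚲^*}` with the product
(Lemma 5.1.1) `(F' ⋆ F'')_z = Σ_{(z',z'') ∈ S_z} F'_{z'} F''_{z''}` over complementary pairs of
subsequences, the pairing `⟨F, g⟩ = Σ_z (1/z!) F_z g_z` with test functions and the seminorm
`‖F‖_T = sup_{g ∈ B(Φ)} |⟨F,g⟩|` (Proposition 5.1.2: `‖F ⋆ G‖_T ≤ ‖F‖_T‖G‖_T`). The proof of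
Proposition 5.1.2 regroups `⟨F ⋆ G, g⟩ = ⟨F, G*g⟩` with the adjoint
`(G*g)_{z'} = Σ_{z''} (1/z''!) G_{z''} f_{z',z''}`, `f_{z',z''} = Σ_{z ∈ z'◇z''} (z'!z''!/z!) g_z` the
average of `g` over the interleavings of `z'` and `z''` ("the number of `z` in the set `z'◇z''` is
`z!/(z'!z''!)`"), and shows `‖G*g‖_Φ ≤ ‖G‖_T` for `g ∈ B(Φ)` by passing the test-function
functionals `λ_{α,z} = w_{α,z}⁻¹∇^α` through the pairing ("because they are linear") and using, for
each interleaving, "`|λ_{α'',z''}λ_{α',z'} g_z| ≤ 1` … a consequence of `g ∈ B(Φ)` and the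
definition of the `Φ` norm". This file formalises exactly this, for one real boson species:

* `splits`, `masks`, `merge`, `length_masks` (`= binomial`), `sumSeq` (sums over all sequences of a
  length) and **`sumSeq_splits`** — the regrouping of the sum over `(z, (z',z'') ∈ S_z)` as the sum
  over `(z', z'', z ∈ z'◇z'')`, interleavings being Boolean masks;
* `pairing` (truncated at length `p_𝒩`), `star` (Lemma 5.1.1 as the definition), `shAvg`
  (`f_{z',z''}`), `adj` (`G*g`) and **`pairing_star`**: `⟨F ⋆ G, g⟩ = ⟨F, G*g⟩` for test functions
  vanishing beyond length `p_𝒩`;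
* the unit ball `B(Φ)` (`ball`) of a family `𝓛` of **test functionals** (`TestFunctional`: linear
  forms reading one length of sequences — the `λ_{α,z}`; the `Φ` norm is their supremum), the
  **shuffle property** of such a family (`ShuffleCompat` — the inequality
  `|λ_{α'',z''}λ_{α',z'} f_{z',z''}| ≤ 1`, isolated as the one property of the family the printed
  proof uses; it is PROVED for the lattice norms `Φ_j(𝔥)` of Example 3.3.2 / Slade (6.28) in
  `…TestFunctionNorm.lean`), `adj_polar` (`G*g ∈ ‖G‖_T · B(Φ)`), and **Proposition 5.1.2** in dual
  form (`abs_pairing_star_le`) and for the seminorm `Tnorm F = sup_{B(Φ)} |⟨F,·⟩|` (`Tnorm_star_le`),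
  with `abs_pairing_le_Tnorm`, `Tnorm_add_le`, `abs_nil_le_Tnorm` (`|F_∅| ≤ ‖F‖_T`),
  `abs_pairing_le_Tnorm_mul` (`|⟨F,g⟩| ≤ ‖F‖_T‖g‖_Φ`).

The sequel `…TphiCalculus.lean` transports this to `𝒩` (smooth functions of the field: the
coefficient map `F ↦ (F_z(φ))_z` is an algebra homomorphism onto `(𝓕,⋆)` by the Leibniz rule —
the isometry "`(𝒩,T_φ) ≅ (𝓕,T)`" of the proof of Proposition 3.4.5), and `…TestFunctionNorm.lean`
constructs the lattice functionals `λ_{α,z}` with finite-difference derivatives and proves their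
shuffle property, giving Proposition 3.4.5 for Slade's `T_{φ,j}(𝔥_j)`.

Faithfulness notes. (i) `p_𝒩` is finite here (BS allow `+∞`; Slade fixes `p_𝒩 ≥ 10`). (ii) The
truncation "`g_z = 0` whenever `z` has more than `p_𝒩` components" (Definition 3.3.1) is part of
`ball`; the pairing sums over `|z| ≤ p_𝒩`. (iii) Everything is proved; no named fact is introduced.
Ledger effect: none on the trust base of the barrier's reduction chain (`Slade2017_prop822`); this
is the first layer of the norm apparatus in which Theorem 6.3.1 is stated.
-/

noncomputable section

namespace Literature.Barriers.CriticalPhenomena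

namespace LongRangePhi4

namespace Tphi

open Finset

variable {Ξ : Type*}

/-! ### Complementary pairs of subsequences -/

/-- `splits z` lists the pairs `(z', z'')` of complementary subsequences of `z` ("`(z',z'')`
complementary with respect to `z`: `z'` is a subsequence of `z` and `z''` is the sequence obtained
by removing `z'` from `z`; the pairs such that `z'` or `z''` is the empty sequence are included"),
with multiplicity — the set `S_z` of [cite: BrydgesSlade2015RGI, §5.1 (before Lemma 5.1.1)]. -/
def splits : List Ξ → List (List Ξ × List Ξ)
  | [] => [([], [])]
  | a :: z => (splits z).map (fun p => (a :: p.1, p.2)) ++ (splits z).map (fun p => (p.1, a :: p.2))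

/-- `S_∅ = {(∅, ∅)}`. [folklore] -/
@[simp] theorem splits_nil : splits ([] : List Ξ) = [([], [])] := rfl

/-- Recursion for `S_{a·z}`: `a` goes to the first or to the second subsequence. [folklore] -/
theorem splits_cons (a : Ξ) (z : List Ξ) :
    splits (a :: z) =
      (splits z).map (fun p => (a :: p.1, p.2)) ++ (splits z).map (fun p => (p.1, a :: p.2)) := rfl

/-- Summing over `S_{a·z}` = summing over `S_z` the two ways of placing `a`. [folklore] -/
theorem sum_splits_cons {M : Type*} [AddCommMonoid M] (f : List Ξ × List Ξ → M) (a : Ξ)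
    (z : List Ξ) :
    ((splits (a :: z)).map f).sum =
      ((splits z).map fun p => f (a :: p.1, p.2) + f (p.1, a :: p.2)).sum := by
  rw [splits_cons, List.map_append, List.sum_append, List.map_map, List.map_map,
    List.sum_map_add]
  rfl

/-- Complementary subsequences have total length `|z|`. [folklore] -/
theorem length_add_of_mem_splits :
    ∀ {z : List Ξ} {p : List Ξ × List Ξ}, p ∈ splits z → p.1.length + p.2.length = z.length
  | [], p, hp => by
      simp only [splits_nil, List.mem_singleton] at hp
      subst hp; simp
  | a :: z, p, hp => by
      simp only [splits_cons, List.mem_append, List.mem_map] at hp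
      rcases hp with ⟨q, hq, rfl⟩ | ⟨q, hq, rfl⟩
      · have := length_add_of_mem_splits hq
        simp only [List.length_cons]; omega
      · have := length_add_of_mem_splits hq
        simp only [List.length_cons]; omega

/-! ### Interleaving masks and merging -/

/-- Merge two sequences along a Boolean mask (`true` = take from the first sequence). [folklore] -/
def merge : List Bool → List Ξ → List Ξ → List Ξ
  | [], _, _ => []
  | true :: m, a :: u, v => a :: merge m u v
  | true :: m, [], v => merge m [] v
  | false :: m, u, b :: v => b :: merge m u v
  | false :: m, u, [] => merge m u []

/-- Merging along the empty mask gives the empty sequence. [folklore] -/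
@[simp] theorem merge_nil (u v : List Ξ) : merge [] u v = [] := by
  cases u <;> cases v <;> rfl

/-- A mask starting with `true` takes the head of the first sequence. [folklore] -/
@[simp] theorem merge_true_cons (m : List Bool) (a : Ξ) (u v : List Ξ) :
    merge (true :: m) (a :: u) v = a :: merge m u v := by
  cases v <;> rfl

/-- A mask starting with `false` takes the head of the second sequence. [folklore] -/
@[simp] theorem merge_false_cons (m : List Bool) (u : List Ξ) (b : Ξ) (v : List Ξ) :
    merge (false :: m) u (b :: v) = b :: merge m u v := by
  cases u <;> rfl

/-- `masks k l`: the Boolean lists with `k` entries `true` and `l` entries `false` — the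
interleavings `z' ◇ z''` of a sequence of length `k` with one of length `l`
[cite: BrydgesSlade2015RGI, §5.1 (before Lemma 5.1.1)]. -/
def masks : ℕ → ℕ → List (List Bool)
  | 0, l => [List.replicate l false]
  | k + 1, 0 => [List.replicate (k + 1) true]
  | k + 1, l + 1 => (masks k (l + 1)).map (true :: ·) ++ (masks (k + 1) l).map (false :: ·)
termination_by k l => k + l

/-- `masks 0 l`: the single all-`false` mask. [folklore] -/
@[simp] theorem masks_zero (l : ℕ) : masks 0 l = [List.replicate l false] := by
  rw [masks]

/-- `masks (k+1) 0`: the single all-`true` mask. [folklore] -/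
theorem masks_succ_zero (k : ℕ) : masks (k + 1) 0 = [List.replicate (k + 1) true] := by
  rw [masks]

/-- Recursion for `masks (k+1) (l+1)` according to the first entry. [folklore] -/
theorem masks_succ_succ (k l : ℕ) :
    masks (k + 1) (l + 1) = (masks k (l + 1)).map (true :: ·) ++ (masks (k + 1) l).map (false :: ·) := by
  rw [masks]

/-- `masks k 0`: the single all-`true` mask. [folklore] -/
theorem masks_zero' (k : ℕ) : masks k 0 = [List.replicate k true] := by
  cases k
  · simp
  · exact masks_succ_zero _

/-- "The number of `z` in the set `z' ◇ z''` is `z!/(z'!z''!)`."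
[cite: BrydgesSlade2015RGI, §5.1 (proof of Lemma 5.1.1)] -/
theorem length_masks : ∀ k l : ℕ, (masks k l).length = (k + l).choose k
  | 0, l => by simp
  | k + 1, 0 => by simp [masks_succ_zero]
  | k + 1, l + 1 => by
      rw [masks_succ_succ, List.length_append, List.length_map, List.length_map,
        length_masks k (l + 1), length_masks (k + 1) l]
      have h : k + 1 + (l + 1) = (k + l + 1) + 1 := by omega
      have e1 : k + (l + 1) = k + l + 1 := by omega
      have e2 : k + 1 + l = k + l + 1 := by omega
      rw [h, Nat.choose_succ_succ, add_comm ((k + l + 1).choose k), e1, e2, Nat.succ_eq_add_one,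
        add_comm]
termination_by k l => k + l

/-- There is at least one interleaving. [folklore] -/
theorem length_masks_pos (k l : ℕ) : 0 < (masks k l).length := by
  rw [length_masks]
  exact Nat.choose_pos (Nat.le_add_right k l)

/-- An interleaving of sequences of lengths `k` and `l` has length `k + l`. [folklore] -/
theorem length_merge_of_mem_masks :
    ∀ {k l : ℕ} {m : List Bool}, m ∈ masks k l → ∀ {u v : List Ξ},
      u.length = k → v.length = l → (merge m u v).length = k + l
  | 0, l, m, hm, u, v, hu, hv => by
      simp only [masks_zero, List.mem_singleton] at hm
      subst hm
      cases u with
      | nil =>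
        subst hv
        induction v with
        | nil => simp
        | cons b v ih => simp [List.replicate_succ, ih]
      | cons a u => simp at hu
  | k + 1, 0, m, hm, u, v, hu, hv => by
      rw [masks_succ_zero, List.mem_singleton] at hm
      subst hm
      cases v with
      | nil =>
        clear hv
        induction u generalizing k with
        | nil => simp at hu
        | cons a u ih =>
          cases k with
          | zero =>
            simp only [List.length_cons] at hu
            have : u = [] := List.eq_nil_of_length_eq_zero (by omega)
            subst this
            simp [List.replicate_succ, merge]
          | succ k =>
            simp only [List.length_cons, add_left_inj] at hu
            rw [List.replicate_succ, merge_true_cons, List.length_cons, ih _ hu]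
      | cons b v => simp at hv
  | k + 1, l + 1, m, hm, u, v, hu, hv => by
      rw [masks_succ_succ, List.mem_append, List.mem_map, List.mem_map] at hm
      rcases hm with ⟨m', hm', rfl⟩ | ⟨m', hm', rfl⟩
      · cases u with
        | nil => simp at hu
        | cons a u =>
          simp only [List.length_cons, add_left_inj] at hu
          rw [merge_true_cons, List.length_cons, length_merge_of_mem_masks hm' hu hv]
          omega
      · cases v with
        | nil => simp at hv
        | cons b v =>
          simp only [List.length_cons, add_left_inj] at hv
          rw [merge_false_cons, List.length_cons, length_merge_of_mem_masks hm' hu hv]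
          omega
termination_by k l => k + l

/-! ### Sums over all sequences of a given length -/

section sumSeq

variable [Fintype Ξ]

/-- `sumSeq r f = Σ_{z : |z| = r} f z`, the sum over all sequences of length `r`. [folklore] -/
def sumSeq {M : Type*} [AddCommMonoid M] : ℕ → (List Ξ → M) → M
  | 0, f => f []
  | r + 1, f => ∑ a : Ξ, sumSeq r (fun z => f (a :: z))

/-- The only sequence of length `0` is the empty one. [folklore] -/
@[simp] theorem sumSeq_zero {M : Type*} [AddCommMonoid M] (f : List Ξ → M) : sumSeq 0 f = f [] := rfl

/-- Peeling off the first entry of a sequence of length `r+1`. [folklore] -/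
theorem sumSeq_succ {M : Type*} [AddCommMonoid M] (r : ℕ) (f : List Ξ → M) :
    sumSeq (r + 1) f = ∑ a : Ξ, sumSeq r (fun z => f (a :: z)) := rfl

/-- `sumSeq r f` depends only on `f` on sequences of length `r`. [folklore] -/
theorem sumSeq_congr {M : Type*} [AddCommMonoid M] :
    ∀ (r : ℕ) {f g : List Ξ → M}, (∀ z, z.length = r → f z = g z) → sumSeq r f = sumSeq r g
  | 0, f, g, h => h [] rfl
  | r + 1, f, g, h => by
      rw [sumSeq_succ, sumSeq_succ]
      exact Finset.sum_congr rfl fun a _ => sumSeq_congr r fun z hz => h (a :: z) (by simp [hz])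

/-- Additivity of `sumSeq` in the summand. [folklore] -/
theorem sumSeq_add {M : Type*} [AddCommMonoid M] :
    ∀ (r : ℕ) (f g : List Ξ → M), sumSeq r (fun z => f z + g z) = sumSeq r f + sumSeq r g
  | 0, f, g => rfl
  | r + 1, f, g => by
      simp only [sumSeq_succ, sumSeq_add r, Finset.sum_add_distrib]

/-- `sumSeq` of the zero summand vanishes. [folklore] -/
theorem sumSeq_zero_fun {M : Type*} [AddCommMonoid M] : ∀ r : ℕ, sumSeq r (fun _ : List Ξ => (0 : M)) = 0
  | 0 => rfl
  | r + 1 => by simp [sumSeq_succ, sumSeq_zero_fun r]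

/-- `sumSeq` commutes with scalar multiplication. [folklore] -/
theorem sumSeq_smul {M : Type*} [AddCommMonoid M] {R : Type*} [Monoid R] [DistribMulAction R M] :
    ∀ (r : ℕ) (c : R) (f : List Ξ → M), sumSeq r (fun z => c • f z) = c • sumSeq r f
  | 0, c, f => rfl
  | r + 1, c, f => by
      simp only [sumSeq_succ, sumSeq_smul r, Finset.smul_sum]

/-- `sumSeq` commutes with multiplication by a constant. [folklore] -/
theorem sumSeq_mul_left : ∀ (r : ℕ) (c : ℝ) (f : List Ξ → ℝ),
    sumSeq r (fun z => c * f z) = c * sumSeq r f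
  | 0, c, f => rfl
  | r + 1, c, f => by
      simp only [sumSeq_succ, sumSeq_mul_left r, Finset.mul_sum]

/-- An additive map commutes with `sumSeq`. [folklore] -/
theorem map_sumSeq {M N : Type*} [AddCommMonoid M] [AddCommMonoid N] {F : Type*}
    [FunLike F M N] [AddMonoidHomClass F M N] (φ : F) :
    ∀ (r : ℕ) (f : List Ξ → M), φ (sumSeq r f) = sumSeq r (fun z => φ (f z))
  | 0, f => rfl
  | r + 1, f => by
      simp only [sumSeq_succ, map_sum, map_sumSeq φ r]

/-- Evaluation commutes with `sumSeq` of function-valued summands. [folklore] -/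
theorem sumSeq_apply {α : Type*} {M : Type*} [AddCommMonoid M] :
    ∀ (r : ℕ) (f : List Ξ → α → M) (x : α), sumSeq r f x = sumSeq r (fun z => f z x)
  | 0, f, x => rfl
  | r + 1, f, x => by
      simp only [sumSeq_succ, Finset.sum_apply, sumSeq_apply r _ x]

/-- Termwise domination bounds `|sumSeq r f|`. [folklore] -/
theorem abs_sumSeq_le : ∀ (r : ℕ) {f : List Ξ → ℝ} {g : List Ξ → ℝ},
    (∀ z, z.length = r → |f z| ≤ g z) → |sumSeq r f| ≤ sumSeq r g
  | 0, f, g, h => h [] rfl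
  | r + 1, f, g, h => by
      rw [sumSeq_succ, sumSeq_succ]
      refine (Finset.abs_sum_le_sum_abs _ _).trans (Finset.sum_le_sum fun a _ => ?_)
      exact abs_sumSeq_le r fun z hz => h (a :: z) (by simp [hz])

/-- `sumSeq` of a nonnegative summand is nonnegative. [folklore] -/
theorem sumSeq_nonneg : ∀ (r : ℕ) {f : List Ξ → ℝ}, (∀ z, z.length = r → 0 ≤ f z) → 0 ≤ sumSeq r f
  | 0, f, h => h [] rfl
  | r + 1, f, h => by
      rw [sumSeq_succ]
      exact Finset.sum_nonneg fun a _ => sumSeq_nonneg r fun z hz => h (a :: z) (by simp [hz])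

/-- Monotonicity of `sumSeq` in the summand. [folklore] -/
theorem sumSeq_mono : ∀ (r : ℕ) {f g : List Ξ → ℝ}, (∀ z, z.length = r → f z ≤ g z) →
    sumSeq r f ≤ sumSeq r g
  | 0, f, g, h => h [] rfl
  | r + 1, f, g, h => by
      rw [sumSeq_succ, sumSeq_succ]
      exact Finset.sum_le_sum fun a _ => sumSeq_mono r fun z hz => h (a :: z) (by simp [hz])


/-- `sumSeq` commutes with finite sums. [folklore] -/
theorem sumSeq_sum {M : Type*} [AddCommMonoid M] {β : Type*} (s : Finset β) :
    ∀ (r : ℕ) (f : List Ξ → β → M),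
      sumSeq r (fun z => ∑ b ∈ s, f z b) = ∑ b ∈ s, sumSeq r (fun z => f z b)
  | 0, f => rfl
  | r + 1, f => by
      simp only [sumSeq_succ]
      rw [Finset.sum_comm]
      exact Finset.sum_congr rfl fun a _ => sumSeq_sum s r _

/-- `sumSeq` commutes with list sums. [folklore] -/
theorem sumSeq_list_sum {M : Type*} [AddCommMonoid M] {β : Type*} (l : List β) (r : ℕ)
    (f : List Ξ → β → M) :
    sumSeq r (fun z => (l.map (f z)).sum) = (l.map fun b => sumSeq r (fun z => f z b)).sum := by
  induction l with
  | nil => simpa using sumSeq_zero_fun (Ξ := Ξ) (M := M) r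
  | cons b l ih => simp only [List.map_cons, List.sum_cons, sumSeq_add, ih]

/-! ### The regrouping identity: complementary pairs versus interleavings -/

/-- `shuffleSum Φ k l = Σ_{|u|=k} Σ_{|v|=l} Σ_{m ∈ masks k l} Φ u v (merge m u v)`: the sum over
pairs of sequences and their interleavings. [folklore] -/
def shuffleSum {M : Type*} [AddCommMonoid M] (Φ : List Ξ → List Ξ → List Ξ → M) (k l : ℕ) : M :=
  sumSeq k (fun u => sumSeq l (fun v => ((masks k l).map fun m => Φ u v (merge m u v)).sum))

section shuffleSum

variable {M : Type*} [AddCommMonoid M]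

/-- `shuffleSum Φ 0 0 = Φ(∅,∅,∅)`. [folklore] -/
theorem shuffleSum_zero_zero (Φ : List Ξ → List Ξ → List Ξ → M) :
    shuffleSum Φ 0 0 = Φ [] [] [] := by
  simp [shuffleSum]

/-- Recursion for `shuffleSum Φ (k+1) 0` (only the all-`true` mask). [folklore] -/
theorem shuffleSum_succ_zero (Φ : List Ξ → List Ξ → List Ξ → M) (k : ℕ) :
    shuffleSum Φ (k + 1) 0 = ∑ a : Ξ, shuffleSum (fun u v w => Φ (a :: u) v (a :: w)) k 0 := by
  simp only [shuffleSum, masks_zero', sumSeq_zero, List.map_cons, List.map_nil, List.sum_cons,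
    List.sum_nil, add_zero, sumSeq_succ, List.replicate_succ, merge_true_cons]

/-- Recursion for `shuffleSum Φ 0 (l+1)` (only the all-`false` mask). [folklore] -/
theorem shuffleSum_zero_succ (Φ : List Ξ → List Ξ → List Ξ → M) (l : ℕ) :
    shuffleSum Φ 0 (l + 1) = ∑ b : Ξ, shuffleSum (fun u v w => Φ u (b :: v) (b :: w)) 0 l := by
  simp only [shuffleSum, masks_zero, sumSeq_zero, List.map_cons, List.map_nil, List.sum_cons,
    List.sum_nil, add_zero, sumSeq_succ, List.replicate_succ, merge_false_cons]

/-- Recursion for `shuffleSum Φ (k+1) (l+1)`: the first letter of the interleaving comes from the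
first or from the second sequence. [folklore] -/
theorem shuffleSum_succ_succ (Φ : List Ξ → List Ξ → List Ξ → M) (k l : ℕ) :
    shuffleSum Φ (k + 1) (l + 1) =
      ∑ a : Ξ, shuffleSum (fun u v w => Φ (a :: u) v (a :: w)) k (l + 1) +
        ∑ b : Ξ, shuffleSum (fun u v w => Φ u (b :: v) (b :: w)) (k + 1) l := by
  have h1 : (sumSeq (k + 1) fun u : List Ξ => sumSeq (l + 1) fun v =>
        (((masks k (l + 1)).map (true :: ·)).map fun m => Φ u v (merge m u v)).sum) =
      ∑ a : Ξ, shuffleSum (fun u v w => Φ (a :: u) v (a :: w)) k (l + 1) := by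
    rw [sumSeq_succ]
    refine Finset.sum_congr rfl fun a _ => ?_
    unfold shuffleSum
    refine sumSeq_congr (Ξ := Ξ) (M := M) k ?_
    intro u _
    refine sumSeq_congr (Ξ := Ξ) (M := M) (l + 1) ?_
    intro v _
    simp only [List.map_map, Function.comp_def, merge_true_cons]
  have h2 : (sumSeq (k + 1) fun u : List Ξ => sumSeq (l + 1) fun v =>
        (((masks (k + 1) l).map (false :: ·)).map fun m => Φ u v (merge m u v)).sum) =
      ∑ b : Ξ, shuffleSum (fun u v w => Φ u (b :: v) (b :: w)) (k + 1) l := by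
    have h : ∀ u : List Ξ, (sumSeq (l + 1) fun v =>
          (((masks (k + 1) l).map (false :: ·)).map fun m => Φ u v (merge m u v)).sum) =
        ∑ b : Ξ, sumSeq l fun v =>
          ((masks (k + 1) l).map fun m => Φ u (b :: v) (b :: merge m u v)).sum := by
      intro u
      rw [sumSeq_succ]
      refine Finset.sum_congr rfl fun b _ => ?_
      refine sumSeq_congr (Ξ := Ξ) (M := M) l ?_
      intro v _
      simp only [List.map_map, Function.comp_def, merge_false_cons]
    simp only [h]
    rw [sumSeq_sum]
    rfl
  rw [← h1, ← h2, ← sumSeq_add]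
  unfold shuffleSum
  refine sumSeq_congr (Ξ := Ξ) (M := M) (k + 1) ?_
  intro u _
  rw [← sumSeq_add]
  refine sumSeq_congr (Ξ := Ξ) (M := M) (l + 1) ?_
  intro v _
  rw [masks_succ_succ, List.map_append, List.sum_append]

/-- **Regrouping complementary pairs as interleavings.** Summing `Φ(z', z'', z)` over all
sequences `z` of length `r` and all complementary pairs `(z', z'') ∈ S_z` is the same as summing
over all pairs `(z', z'')` with `|z'| + |z''| = r` and all interleavings `z ∈ z' ◇ z''` — the
change of summation "`Σ_z (1/z!) Σ_{(z',z'')∈S_z} = Σ_{z',z''} Σ_{z ∈ z'◇z''} (1/z!)`" of the proof of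
Lemma 5.1.1 / Proposition 5.1.2 of [BS-rg-norm], here for an arbitrary summand.
[cite: BrydgesSlade2015RGI, §5.1 (proofs of Lemma 5.1.1 and Proposition 5.1.2)] -/
theorem sumSeq_splits (r : ℕ) :
    ∀ Φ : List Ξ → List Ξ → List Ξ → M,
      sumSeq r (fun z => ((splits z).map fun p => Φ p.1 p.2 z).sum) =
        ∑ kl ∈ antidiagonal r, shuffleSum Φ kl.1 kl.2 := by
  induction r with
  | zero =>
    intro Φ
    simp [shuffleSum_zero_zero]
  | succ r ih =>
    intro Φ
    -- left-hand side: peel off the first element of `z`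
    have hL : sumSeq (r + 1) (fun z => ((splits z).map fun p => Φ p.1 p.2 z).sum) =
        ∑ a : Ξ, ((∑ kl ∈ antidiagonal r, shuffleSum (fun u v w => Φ (a :: u) v (a :: w)) kl.1 kl.2) +
          ∑ kl ∈ antidiagonal r, shuffleSum (fun u v w => Φ u (a :: v) (a :: w)) kl.1 kl.2) := by
      rw [sumSeq_succ]
      refine Finset.sum_congr rfl fun a _ => ?_
      rw [← ih, ← ih, ← sumSeq_add]
      refine sumSeq_congr r fun z _ => ?_
      rw [sum_splits_cons, List.sum_map_add]
    rw [hL, Finset.sum_add_distrib]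
    -- right-hand side: split the interleavings according to their first letter
    set tp : ℕ × ℕ → M := fun kl =>
      if kl.1 = 0 then 0 else ∑ a : Ξ, shuffleSum (fun u v w => Φ (a :: u) v (a :: w)) (kl.1 - 1) kl.2
      with htp
    set fp : ℕ × ℕ → M := fun kl =>
      if kl.2 = 0 then 0 else ∑ b : Ξ, shuffleSum (fun u v w => Φ u (b :: v) (b :: w)) kl.1 (kl.2 - 1)
      with hfp
    have hsplit : ∀ kl ∈ antidiagonal (r + 1), shuffleSum Φ kl.1 kl.2 = tp kl + fp kl := by
      rintro ⟨k, l⟩ hkl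
      rw [mem_antidiagonal] at hkl
      simp only [htp, hfp]
      rcases k with _ | k <;> rcases l with _ | l
      · simp at hkl
      · simp [shuffleSum_zero_succ]
      · simp [shuffleSum_succ_zero]
      · simp [shuffleSum_succ_succ]
    have htp' : ∑ kl ∈ antidiagonal (r + 1), tp kl =
        ∑ kl ∈ antidiagonal r, ∑ a : Ξ, shuffleSum (fun u v w => Φ (a :: u) v (a :: w)) kl.1 kl.2 := by
      rw [Nat.sum_antidiagonal_succ]
      simp [htp]
    have hfp' : ∑ kl ∈ antidiagonal (r + 1), fp kl =
        ∑ kl ∈ antidiagonal r, ∑ b : Ξ, shuffleSum (fun u v w => Φ u (b :: v) (b :: w)) kl.1 kl.2 := by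
      rw [Nat.sum_antidiagonal_succ']
      simp [hfp]
    rw [Finset.sum_congr rfl hsplit, Finset.sum_add_distrib, htp', hfp']
    congr 1 <;> exact Finset.sum_comm

end shuffleSum

end sumSeq


/-! ### A summation lemma -/

/-- `Σ_{r ≤ N} Σ_{k+l=r} f(k,l) = Σ_{k ≤ N} Σ_{l ≤ N} 𝟙[k+l ≤ N] f(k,l)`. [folklore] -/
theorem sum_range_antidiagonal {M : Type*} [AddCommMonoid M] (N : ℕ) (f : ℕ × ℕ → M) :
    ∑ r ∈ range (N + 1), ∑ kl ∈ antidiagonal r, f kl =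
      ∑ k ∈ range (N + 1), ∑ l ∈ range (N + 1), if k + l ≤ N then f (k, l) else 0 := by
  have hdisj : Set.PairwiseDisjoint (↑(range (N + 1)) : Set ℕ) (fun r => antidiagonal r) := by
    intro r _ r' _ hrr'
    rw [Function.onFun, Finset.disjoint_left]
    rintro ⟨k, l⟩ h h'
    rw [mem_antidiagonal] at h h'
    exact hrr' (h.symm.trans h')
  rw [← Finset.sum_biUnion hdisj, ← Finset.sum_product', ← Finset.sum_filter]
  apply Finset.sum_congr _ fun _ _ => rfl
  ext ⟨k, l⟩
  simp only [Finset.mem_biUnion, Finset.mem_range, mem_antidiagonal, Finset.mem_filter,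
    Finset.mem_product]
  constructor
  · rintro ⟨r, hr, hkl⟩
    omega
  · rintro ⟨-, hkl⟩
    exact ⟨k + l, by omega, rfl⟩

/-! ### The `⋆` product and the shuffle average -/

/-- The product `(F ⋆ G)_z = Σ_{(z',z'') ∈ S_z} F_{z'} G_{z''}` on coefficient families (one real
boson species: no signs) — Lemma 5.1.1 of [BS-rg-norm] taken as the definition.
[cite: BrydgesSlade2015RGI, Lemma 5.1.1] -/
def star (F G : List Ξ → ℝ) : List Ξ → ℝ := fun z => ((splits z).map fun p => F p.1 * G p.2).sum

/-- The shuffle average `f_{z',z''} = Σ_{z ∈ z'◇z''} (z'!z''!/z!) g_z`: the average of `g` over the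
interleavings of `z'` and `z''`. [cite: BrydgesSlade2015RGI, §5.1 (proof of Proposition 5.1.2, display defining f_{z',z''})] -/
def shAvg (g : List Ξ → ℝ) (u v : List Ξ) : ℝ :=
  ((masks u.length v.length).map fun m => g (merge m u v)).sum /
    ((u.length + v.length).choose u.length : ℕ)

/-- `|Σ_b f(b)| ≤ Σ_b |f(b)|` for list sums. [folklore] -/
theorem abs_sum_map_le {β : Type*} (l : List β) (f : β → ℝ) :
    |(l.map f).sum| ≤ (l.map fun b => |f b|).sum := by
  induction l with
  | nil => simp
  | cons b l ih =>
    simp only [List.map_cons, List.sum_cons]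
    exact (abs_add_le _ _).trans (by gcongr)

/-- `Σ_{m} g(merge m u v) = binom(|u|+|v|,|u|) · f_{u,v}`. [folklore] -/
theorem sum_masks_eq_choose_mul_shAvg (g : List Ξ → ℝ) (u v : List Ξ) :
    ((masks u.length v.length).map fun m => g (merge m u v)).sum =
      ((u.length + v.length).choose u.length : ℕ) * shAvg g u v := by
  unfold shAvg
  rw [mul_div_cancel₀]
  exact_mod_cast (Nat.choose_pos (Nat.le_add_right _ _)).ne'

/-- The shuffle average of a test function vanishing beyond length `p_𝒩` vanishes when `|z'| + |z''|
> p_𝒩`. [folklore] -/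
theorem shAvg_eq_zero_of_length {pN : ℕ} {g : List Ξ → ℝ} (hg : ∀ z, pN < z.length → g z = 0)
    {u v : List Ξ} (h : pN < u.length + v.length) : shAvg g u v = 0 := by
  unfold shAvg
  rw [div_eq_zero_iff]
  left
  apply List.sum_eq_zero
  intro x hx
  rw [List.mem_map] at hx
  obtain ⟨m, hm, rfl⟩ := hx
  exact hg _ (by rwa [length_merge_of_mem_masks hm rfl rfl])

/-- A uniform bound on `g` over the interleavings bounds the shuffle average `f_{z',z''}`.
[folklore] -/
theorem abs_shAvg_le {g : List Ξ → ℝ} {u v : List Ξ} {C : ℝ}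
    (h : ∀ m ∈ masks u.length v.length, |g (merge m u v)| ≤ C) : |shAvg g u v| ≤ C := by
  unfold shAvg
  have hpos : (0 : ℝ) < ((u.length + v.length).choose u.length : ℕ) := by
    exact_mod_cast Nat.choose_pos (Nat.le_add_right _ _)
  rw [abs_div, abs_of_pos hpos, div_le_iff₀ hpos]
  calc |((masks u.length v.length).map fun m => g (merge m u v)).sum|
      ≤ ((masks u.length v.length).map fun m => |g (merge m u v)|).sum :=
        abs_sum_map_le _ _
    _ ≤ ((masks u.length v.length).map fun _ => C).sum := by
        apply List.sum_le_sum
        · intro m hm; exact h m hm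
    _ = C * ((u.length + v.length).choose u.length : ℕ) := by
        rw [List.map_const', List.sum_replicate, length_masks, nsmul_eq_mul, mul_comm]


section pairing

variable [Fintype Ξ]

/-! ### The pairing, the `⋆` product, the shuffle average and the adjoint -/

/-- The (truncated) pairing `⟨F, g⟩ = Σ_{z : |z| ≤ p_𝒩} (1/z!) F_z g_z`, `z! = |z|!`, of a
coefficient family `F` with a test function `g`
[cite: BrydgesSlade2015RGI, Definition 3.4.1 and §5.1 (display defining ⟨F,g⟩ and ‖F‖_T on 𝓕)]. -/
def pairing (pN : ℕ) (F g : List Ξ → ℝ) : ℝ :=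
  ∑ r ∈ range (pN + 1), ((r.factorial : ℝ)⁻¹) * sumSeq r (fun z => F z * g z)

/-- The adjoint `(G* g)_{z'} = Σ_{z''} (1/z''!) G_{z''} f_{z',z''} = ⟨G, f_{z'}⟩`.
[cite: BrydgesSlade2015RGI, §5.1 (proof of Proposition 5.1.2, display defining G*g)] -/
def adj (pN : ℕ) (G g : List Ξ → ℝ) : List Ξ → ℝ := fun u => pairing pN G (fun v => shAvg g u v)

/-- The pairing is additive in the test function. [folklore] -/
theorem pairing_add_right (pN : ℕ) (F g g' : List Ξ → ℝ) :
    pairing pN F (fun z => g z + g' z) = pairing pN F g + pairing pN F g' := by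
  simp only [pairing, mul_add, sumSeq_add, Finset.sum_add_distrib]

/-- The pairing is homogeneous in the test function. [folklore] -/
theorem pairing_smul_right (pN : ℕ) (F g : List Ξ → ℝ) (c : ℝ) :
    pairing pN F (fun z => c * g z) = c * pairing pN F g := by
  unfold pairing
  rw [Finset.mul_sum]
  refine Finset.sum_congr rfl fun r _ => ?_
  have h : sumSeq r (fun z => F z * (c * g z)) = c * sumSeq r (fun z => F z * g z) := by
    rw [← sumSeq_mul_left]
    exact sumSeq_congr r fun z _ => by ring
  rw [h]
  ring

/-- The pairing with the zero test function vanishes. [folklore] -/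
theorem pairing_zero_right (pN : ℕ) (F : List Ξ → ℝ) : pairing pN F (fun _ => 0) = 0 := by
  simp [pairing, sumSeq_zero_fun]

/-- The pairing only reads the test function on sequences of length `≤ p_𝒩`. [folklore] -/
theorem pairing_congr_right (pN : ℕ) (F : List Ξ → ℝ) {g g' : List Ξ → ℝ}
    (h : ∀ z, z.length ≤ pN → g z = g' z) : pairing pN F g = pairing pN F g' := by
  unfold pairing
  refine Finset.sum_congr rfl fun r hr => ?_
  rw [Finset.mem_range] at hr
  congr 1
  exact sumSeq_congr r fun z hz => by rw [h z (by omega)]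

/-- The pairing as a finite linear combination of the test function's values, in function form:
`(u ↦ ⟨G, H u⟩) = Σ_l (1/l!) Σ_{|v|=l} G_v • (u ↦ H u v)`. [folklore] -/
theorem pairing_fun_eq (pN : ℕ) (G : List Ξ → ℝ) (H : List Ξ → List Ξ → ℝ) :
    (fun u => pairing pN G (H u)) =
      ∑ l ∈ range (pN + 1), ((l.factorial : ℝ)⁻¹) • sumSeq l (fun v => G v • fun u => H u v) := by
  funext u
  simp only [pairing, Finset.sum_apply, Pi.smul_apply, sumSeq_apply, smul_eq_mul]

/-- A bound `|g_z| ≤ C_{|z|}` bounds `|⟨F,g⟩|` by `Σ_r (1/r!) Σ_{|z|=r} |F_z| C_r`. [folklore] -/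
theorem abs_pairing_le (pN : ℕ) (F g : List Ξ → ℝ) (C : ℕ → ℝ)
    (h : ∀ z, z.length ≤ pN → |g z| ≤ C z.length) :
    |pairing pN F g| ≤ ∑ r ∈ range (pN + 1), ((r.factorial : ℝ)⁻¹) * sumSeq r (fun z => |F z| * C r) := by
  unfold pairing
  refine (Finset.abs_sum_le_sum_abs _ _).trans (Finset.sum_le_sum fun r hr => ?_)
  rw [Finset.mem_range] at hr
  rw [abs_mul, abs_of_nonneg (by positivity)]
  refine mul_le_mul_of_nonneg_left (abs_sumSeq_le r fun z hz => ?_) (by positivity)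
  rw [abs_mul, ← hz]
  exact mul_le_mul_of_nonneg_left (h z (by omega)) (abs_nonneg _)

/-- **`⟨F ⋆ G, g⟩ = ⟨F, G* g⟩`** for test functions vanishing on sequences longer than `p_𝒩`
(the display (Gadj) in the proof of Proposition 5.1.2 of [BS-rg-norm]).
[cite: BrydgesSlade2015RGI, §5.1 (proof of Proposition 5.1.2)] -/
theorem pairing_star (pN : ℕ) (F G g : List Ξ → ℝ) (hg : ∀ z, pN < z.length → g z = 0) :
    pairing pN (star F G) g = pairing pN F (adj pN G g) := by
  -- the common value
  set S : ℕ × ℕ → ℝ := fun kl =>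
    ((kl.1.factorial : ℝ)⁻¹ * (kl.2.factorial : ℝ)⁻¹) *
      sumSeq kl.1 (fun u => sumSeq kl.2 (fun v => F u * G v * shAvg g u v)) with hS
  have hS0 : ∀ k l : ℕ, pN < k + l → S (k, l) = 0 := by
    intro k l hkl
    simp only [hS]
    rw [sumSeq_congr k (g := fun _ => 0), sumSeq_zero_fun, mul_zero]
    intro u hu
    rw [sumSeq_congr l (g := fun _ => 0), sumSeq_zero_fun]
    intro v hv
    rw [shAvg_eq_zero_of_length hg (by rw [hu, hv]; exact hkl), mul_zero]
  -- left-hand side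
  have hL : pairing pN (star F G) g = ∑ r ∈ range (pN + 1), ∑ kl ∈ antidiagonal r, S kl := by
    unfold pairing
    refine Finset.sum_congr rfl fun r _ => ?_
    have h1 : sumSeq r (fun z => star F G z * g z) =
        ∑ kl ∈ antidiagonal r, shuffleSum (fun u v w => F u * G v * g w) kl.1 kl.2 := by
      rw [← sumSeq_splits]
      refine sumSeq_congr r fun z _ => ?_
      simp only [star, List.sum_map_mul_right]
    rw [h1, Finset.mul_sum]
    refine Finset.sum_congr rfl ?_
    rintro ⟨k, l⟩ hkl
    rw [mem_antidiagonal] at hkl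
    simp only [hS, shuffleSum]
    have h2 : (sumSeq k fun u => sumSeq l fun v =>
          ((masks k l).map fun m => F u * G v * g (merge m u v)).sum) =
        sumSeq k fun u => sumSeq l fun v =>
          ((k + l).choose k : ℝ) * (F u * G v * shAvg g u v) := by
      refine sumSeq_congr k fun u hu => sumSeq_congr l fun v hv => ?_
      rw [List.sum_map_mul_left]
      have := sum_masks_eq_choose_mul_shAvg g u v
      rw [hu, hv] at this
      rw [this]; ring
    rw [h2]
    simp only [sumSeq_mul_left]
    rw [← mul_assoc]
    congr 1
    rw [← hkl]
    have hk : (k.factorial : ℝ) ≠ 0 := by positivity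
    have hl : (l.factorial : ℝ) ≠ 0 := by positivity
    have hkl' : ((k + l).factorial : ℝ) ≠ 0 := by positivity
    have hc : ((k + l).choose k : ℝ) * (k.factorial : ℝ) * (l.factorial : ℝ) = (k + l).factorial := by
      have := Nat.add_choose_mul_factorial_mul_factorial k l
      -- `(k+l).choose l * k! * l! = (k+l)!`; convert `choose l` to `choose k`
      rw [← Nat.choose_symm_add] at this
      exact_mod_cast this
    field_simp
    linarith [hc]
  -- right-hand side
  have hR : pairing pN F (adj pN G g) =
      ∑ k ∈ range (pN + 1), ∑ l ∈ range (pN + 1), S (k, l) := by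
    unfold adj pairing
    refine Finset.sum_congr rfl fun k _ => ?_
    have h3 : (sumSeq k fun z => F z * ∑ l ∈ range (pN + 1),
          ((l.factorial : ℝ)⁻¹) * sumSeq l fun v => G v * shAvg g z v) =
        ∑ l ∈ range (pN + 1), (l.factorial : ℝ)⁻¹ *
          sumSeq k fun u => sumSeq l fun v => F u * G v * shAvg g u v := by
      rw [Finset.sum_congr rfl fun l _ => (sumSeq_mul_left k _ _).symm, ← sumSeq_sum]
      refine sumSeq_congr k fun u _ => ?_
      rw [Finset.mul_sum]
      refine Finset.sum_congr rfl fun l _ => ?_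
      simp only [← sumSeq_mul_left]
      exact sumSeq_congr l fun v _ => by ring
    rw [h3, Finset.mul_sum]
    refine Finset.sum_congr rfl fun l _ => ?_
    simp only [hS]
    ring
  rw [hL, hR, sum_range_antidiagonal]
  refine Finset.sum_congr rfl fun k _ => Finset.sum_congr rfl fun l _ => ?_
  split_ifs with h
  · rfl
  · exact (hS0 k l (by omega)).symm


/-- The pairing is additive in the coefficient family. [folklore] -/
theorem pairing_add_left (pN : ℕ) (F F' g : List Ξ → ℝ) :
    pairing pN (fun z => F z + F' z) g = pairing pN F g + pairing pN F' g := by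
  simp only [pairing, add_mul, sumSeq_add, mul_add, Finset.sum_add_distrib]

/-- Pairing with the indicator of the empty sequence picks out `F_∅`. [folklore] -/
theorem pairing_indicator_nil (pN : ℕ) (F : List Ξ → ℝ) :
    pairing pN F (fun z => if z = [] then 1 else 0) = F [] := by
  unfold pairing
  rw [Finset.sum_eq_single 0]
  · simp
  · intro r hr hr0
    rw [sumSeq_congr r (g := fun _ => 0), sumSeq_zero_fun, mul_zero]
    intro z hz
    have : z ≠ [] := by rintro rfl; exact hr0 (by simpa using hz.symm)
    simp [this]
  · intro h; simp at h

/-! ### Test functionals, the unit ball of test functions, the `T`-seminorm -/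

/-- A **test functional**: a linear form on test functions which reads only the values on
sequences of one length `len` — in [BS-rg-norm] the forms `g ↦ w_{α,z}⁻¹ ∇^α g_z`, `(α,z) ∈ 𝒜`,
`|z| = len`, whose supremum is the `Φ(w)` norm of Definition 3.3.1.
[cite: BrydgesSlade2015RGI, Definition 3.3.1] -/
structure TestFunctional (Ξ : Type*) where
  /-- the length of the sequences read by the functional -/
  len : ℕ
  /-- the linear form -/
  toFun : (List Ξ → ℝ) →ₗ[ℝ] ℝ
  /-- locality: the value depends only on the test function on sequences of length `len` -/
  local' : ∀ g g' : List Ξ → ℝ, (∀ z, z.length = len → g z = g' z) → toFun g = toFun g'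

/-- The **unit ball `B(Φ)`** of test functions determined by a family `𝓛` of test functionals:
test functions vanishing on sequences longer than `p_𝒩` ("test functions such that `g_z = 0`
whenever `z` has more than `p_𝒩` components") with `|ℓ(g)| ≤ 1` for all `ℓ ∈ 𝓛` (`‖g‖_Φ ≤ 1`,
the `Φ` norm being the supremum of the `|ℓ(g)|`). [cite: BrydgesSlade2015RGI, Definition 3.3.1] -/
def ball (pN : ℕ) (𝓛 : Set (TestFunctional Ξ)) : Set (List Ξ → ℝ) :=
  {g | (∀ z, pN < z.length → g z = 0) ∧ ∀ ℓ ∈ 𝓛, |ℓ.toFun g| ≤ 1}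

omit [Fintype Ξ] in
/-- `0 ∈ B(Φ)`. [folklore] -/
theorem zero_mem_ball (pN : ℕ) (𝓛 : Set (TestFunctional Ξ)) : (fun _ => (0 : ℝ)) ∈ ball pN 𝓛 := by
  refine ⟨fun _ _ => rfl, fun ℓ _ => ?_⟩
  rw [show (fun _ : List Ξ => (0 : ℝ)) = 0 from rfl, map_zero, abs_zero]
  exact zero_le_one

omit [Fintype Ξ] in
/-- Scaling a truncated test function with `|ℓ(g)| ≤ b` by `c ≥ 0`, `cb ≤ 1`, puts it in `B(Φ)`.
[folklore] -/
theorem smul_mem_ball {pN : ℕ} {𝓛 : Set (TestFunctional Ξ)} {g : List Ξ → ℝ} {c b : ℝ}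
    (htr : ∀ z, pN < z.length → g z = 0) (hpol : ∀ ℓ ∈ 𝓛, |ℓ.toFun g| ≤ b)
    (hc : 0 ≤ c) (hcb : c * b ≤ 1) : (fun z => c * g z) ∈ ball pN 𝓛 := by
  refine ⟨fun z hz => by simp only [htr z hz, mul_zero], fun ℓ hℓ => ?_⟩
  rw [show (fun z : List Ξ => c * g z) = c • g from rfl, map_smul, smul_eq_mul, abs_mul,
    abs_of_nonneg hc]
  exact (mul_le_mul_of_nonneg_left (hpol ℓ hℓ) hc).trans hcb

/-- **The shuffle property of a family of test functionals** — the inequality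
"`|λ_{α'',z''} λ_{α',z'} f_{z',z''}| ≤ 1` for all `g ∈ B(Φ)`" at the end of the proof of
Proposition 5.1.2 of [BS-rg-norm], isolated as a hypothesis on the family: applying a test
functional in each of the two variables of the shuffle average of a test function in the unit ball
gives a number of modulus at most one. It holds for the lattice norms `Φ_j(𝔥_j)` (proved in the
sibling file). [cite: BrydgesSlade2015RGI, §5.1 (proof of Proposition 5.1.2, displays (lamlam1)–(lam1))] -/
def ShuffleCompat (pN : ℕ) (𝓛 : Set (TestFunctional Ξ)) : Prop :=
  ∀ g ∈ ball pN 𝓛, ∀ ℓ ∈ 𝓛, ∀ ℓ' ∈ 𝓛,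
    |ℓ'.toFun (fun v => ℓ.toFun (fun u => shAvg g u v))| ≤ 1

/-- A test functional passes through the pairing: `ℓ(u ↦ ⟨G, H(u,·)⟩) = ⟨G, v ↦ ℓ(u ↦ H(u,v))⟩`
("the operations `λ_{α',z'}` can be interchanged with the summation because they are linear").
[cite: BrydgesSlade2015RGI, §5.1 (proof of Proposition 5.1.2)] -/
theorem TestFunctional.apply_pairing (ℓ : TestFunctional Ξ) (pN : ℕ) (G : List Ξ → ℝ)
    (H : List Ξ → List Ξ → ℝ) :
    ℓ.toFun (fun u => pairing pN G (H u)) = pairing pN G (fun v => ℓ.toFun (fun u => H u v)) := by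
  rw [pairing_fun_eq, map_sum]
  unfold pairing
  refine Finset.sum_congr rfl fun l _ => ?_
  rw [map_smul, smul_eq_mul, map_sumSeq]
  congr 1
  refine sumSeq_congr l fun v _ => ?_
  rw [map_smul, smul_eq_mul]

/-- **The adjoint maps the unit ball into the ball of radius `‖G‖_T`**: if `|⟨G, h⟩| ≤ b` on
`B(Φ)`, then `G* g` vanishes beyond `p_𝒩` and `|ℓ(G* g)| ≤ b` for every test functional `ℓ` and
every `g ∈ B(Φ)` ("it remains to show that `‖G* g‖_Φ ≤ ‖G‖_T` for `g ∈ B(Φ)`").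
[cite: BrydgesSlade2015RGI, §5.1 (proof of Proposition 5.1.2)] -/
theorem adj_polar {pN : ℕ} {𝓛 : Set (TestFunctional Ξ)} (hSH : ShuffleCompat pN 𝓛)
    {G : List Ξ → ℝ} {b : ℝ} (hb : ∀ h ∈ ball pN 𝓛, |pairing pN G h| ≤ b)
    {g : List Ξ → ℝ} (hg : g ∈ ball pN 𝓛) :
    (∀ u, pN < u.length → adj pN G g u = 0) ∧ ∀ ℓ ∈ 𝓛, |ℓ.toFun (adj pN G g)| ≤ b := by
  constructor
  · intro u hu
    unfold adj
    rw [pairing_congr_right pN G (g' := fun _ => 0), pairing_zero_right]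
    intro v _
    exact shAvg_eq_zero_of_length hg.1 (by omega)
  · intro ℓ hℓ
    unfold adj
    rw [ℓ.apply_pairing]
    apply hb
    refine ⟨fun v hv => ?_, fun ℓ' hℓ' => hSH g hg ℓ hℓ ℓ' hℓ'⟩
    show ℓ.toFun (fun u => shAvg g u v) = 0
    rw [ℓ.local' _ (fun _ => 0), show (fun _ : List Ξ => (0 : ℝ)) = 0 from rfl, map_zero]
    intro u hu
    exact shAvg_eq_zero_of_length hg.1 (by omega)

/-- **The product property in dual form** (Proposition 5.1.2 of [BS-rg-norm]): if
`|⟨F, g⟩| ≤ a` and `|⟨G, g⟩| ≤ b` for all `g` in the unit ball `B(Φ)`, then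
`|⟨F ⋆ G, g⟩| ≤ ab` on `B(Φ)` — for any family of test functionals with the shuffle property.
The proof is the printed one: `⟨F ⋆ G, g⟩ = ⟨F, G* g⟩` and `G* g ∈ b · B(Φ)`.
[cite: BrydgesSlade2015RGI, Proposition 5.1.2] -/
theorem abs_pairing_star_le {pN : ℕ} {𝓛 : Set (TestFunctional Ξ)} (hSH : ShuffleCompat pN 𝓛)
    {F G : List Ξ → ℝ} {a b : ℝ} (ha : ∀ g ∈ ball pN 𝓛, |pairing pN F g| ≤ a)
    (hb : ∀ g ∈ ball pN 𝓛, |pairing pN G g| ≤ b) {g : List Ξ → ℝ} (hg : g ∈ ball pN 𝓛) :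
    |pairing pN (star F G) g| ≤ a * b := by
  have ha0 : 0 ≤ a := (abs_nonneg _).trans (ha _ (zero_mem_ball pN 𝓛))
  have hb0 : 0 ≤ b := (abs_nonneg _).trans (hb _ (zero_mem_ball pN 𝓛))
  obtain ⟨htr, hpol⟩ := adj_polar hSH hb hg
  rw [pairing_star pN F G g hg.1]
  -- `|⟨F, G*g⟩| ≤ a (b + δ)` for every `δ > 0`
  have key : ∀ δ : ℝ, 0 < δ → |pairing pN F (adj pN G g)| ≤ a * (b + δ) := by
    intro δ hδ
    have hbδ : 0 < b + δ := by linarith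
    have hmem : (fun z => (b + δ)⁻¹ * adj pN G g z) ∈ ball pN 𝓛 :=
      smul_mem_ball htr hpol (inv_nonneg.2 hbδ.le)
        (by rw [inv_mul_le_iff₀ hbδ]; linarith)
    have h1 := ha _ hmem
    rw [pairing_smul_right, abs_mul, abs_of_pos (inv_pos.2 hbδ), inv_mul_le_iff₀ hbδ] at h1
    linarith
  apply le_of_forall_pos_le_add
  intro ε hε
  rcases ha0.eq_or_lt with ha0' | ha0'
  · have := key 1 one_pos
    rw [← ha0'] at this ⊢
    linarith
  · have := key (ε / a) (div_pos hε ha0')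
    rwa [mul_add, mul_div_cancel₀ _ ha0'.ne'] at this

/-! ### The `T`-seminorm as a supremum -/

/-- The **`T`-seminorm** `‖F‖_T = sup_{g ∈ B(Φ)} |⟨F, g⟩|` of a coefficient family.
[cite: BrydgesSlade2015RGI, §5.1 (display defining ‖F‖_T) and Definition 3.4.1] -/
def Tnorm (pN : ℕ) (𝓛 : Set (TestFunctional Ξ)) (F : List Ξ → ℝ) : ℝ :=
  sSup ((fun g => |pairing pN F g|) '' ball pN 𝓛)

/-- Boundedness of the unit ball on short sequences (for the lattice norms: `|g_z| ≤ 𝔥^{|z|}`),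
which makes the `T`-seminorm finite. [folklore] -/
def EvalBound (pN : ℕ) (𝓛 : Set (TestFunctional Ξ)) (C : ℕ → ℝ) : Prop :=
  ∀ g ∈ ball pN 𝓛, ∀ z : List Ξ, z.length ≤ pN → |g z| ≤ C z.length

/-- The supremum defining `‖F‖_T` is over a bounded set. [folklore] -/
theorem Tnorm_bddAbove {pN : ℕ} {𝓛 : Set (TestFunctional Ξ)} {C : ℕ → ℝ}
    (hC : EvalBound pN 𝓛 C) (F : List Ξ → ℝ) :
    BddAbove ((fun g => |pairing pN F g|) '' ball pN 𝓛) := by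
  refine ⟨∑ r ∈ range (pN + 1), ((r.factorial : ℝ)⁻¹) * sumSeq r (fun z => |F z| * C r), ?_⟩
  rintro _ ⟨g, hg, rfl⟩
  exact abs_pairing_le pN F g C (hC g hg)

/-- `|⟨F, g⟩| ≤ ‖F‖_T` for `g ∈ B(Φ)` (definition of the supremum). [folklore] -/
theorem abs_pairing_le_Tnorm {pN : ℕ} {𝓛 : Set (TestFunctional Ξ)} {C : ℕ → ℝ}
    (hC : EvalBound pN 𝓛 C) (F : List Ξ → ℝ) {g : List Ξ → ℝ} (hg : g ∈ ball pN 𝓛) :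
    |pairing pN F g| ≤ Tnorm pN 𝓛 F :=
  le_csSup (Tnorm_bddAbove hC F) ⟨g, hg, rfl⟩

/-- `0 ≤ ‖F‖_T`. [folklore] -/
theorem Tnorm_nonneg (pN : ℕ) (𝓛 : Set (TestFunctional Ξ)) (F : List Ξ → ℝ) :
    0 ≤ Tnorm pN 𝓛 F := by
  apply Real.sSup_nonneg
  rintro _ ⟨g, _, rfl⟩
  exact abs_nonneg _

/-- `‖F‖_T ≤ a` as soon as `|⟨F,g⟩| ≤ a` on `B(Φ)`. [folklore] -/
theorem Tnorm_le {pN : ℕ} {𝓛 : Set (TestFunctional Ξ)} {F : List Ξ → ℝ} {a : ℝ}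
    (ha : ∀ g ∈ ball pN 𝓛, |pairing pN F g| ≤ a) : Tnorm pN 𝓛 F ≤ a := by
  refine csSup_le ⟨_, ⟨_, zero_mem_ball pN 𝓛, rfl⟩⟩ ?_
  rintro _ ⟨g, hg, rfl⟩
  exact ha g hg

/-- `|F_∅| ≤ ‖F‖_T` whenever the indicator of the empty sequence is an admissible test function
("`‖F‖_{T_φ}` is always at least as large as `|F_∅|`"). [cite: BrydgesSlade2015RGI, §3.4 (remark after the display for ‖F‖_{T_φ})] -/
theorem abs_nil_le_Tnorm {pN : ℕ} {𝓛 : Set (TestFunctional Ξ)} {C : ℕ → ℝ} (hC : EvalBound pN 𝓛 C)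
    (h1 : (fun z : List Ξ => if z = [] then (1 : ℝ) else 0) ∈ ball pN 𝓛) (F : List Ξ → ℝ) :
    |F []| ≤ Tnorm pN 𝓛 F := by
  have := abs_pairing_le_Tnorm hC F h1
  rwa [pairing_indicator_nil] at this

/-- Subadditivity of the `T`-seminorm ("the triangle inequality holds by definition"). [folklore] -/
theorem Tnorm_add_le {pN : ℕ} {𝓛 : Set (TestFunctional Ξ)} {C : ℕ → ℝ} (hC : EvalBound pN 𝓛 C)
    (F F' : List Ξ → ℝ) :
    Tnorm pN 𝓛 (fun z => F z + F' z) ≤ Tnorm pN 𝓛 F + Tnorm pN 𝓛 F' := by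
  refine Tnorm_le fun g hg => ?_
  rw [pairing_add_left]
  exact (abs_add_le _ _).trans
    (add_le_add (abs_pairing_le_Tnorm hC F hg) (abs_pairing_le_Tnorm hC F' hg))

/-- Homogeneity of the bound: a test function vanishing beyond `p_𝒩` with `|ℓ(g)| ≤ b` for all
test functionals pairs with `F` to at most `‖F‖_T · b` (i.e. `|⟨F,g⟩| ≤ ‖F‖_T ‖g‖_Φ`). [folklore] -/
theorem abs_pairing_le_Tnorm_mul {pN : ℕ} {𝓛 : Set (TestFunctional Ξ)} {C : ℕ → ℝ}
    (hC : EvalBound pN 𝓛 C) (F : List Ξ → ℝ) {g : List Ξ → ℝ} {b : ℝ}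
    (htr : ∀ z, pN < z.length → g z = 0) (hpol : ∀ ℓ ∈ 𝓛, |ℓ.toFun g| ≤ b) (hb : 0 ≤ b) :
    |pairing pN F g| ≤ Tnorm pN 𝓛 F * b := by
  have hT := Tnorm_nonneg pN 𝓛 F
  have key : ∀ δ : ℝ, 0 < δ → |pairing pN F g| ≤ Tnorm pN 𝓛 F * (b + δ) := by
    intro δ hδ
    have hbδ : 0 < b + δ := by linarith
    have hmem : (fun z => (b + δ)⁻¹ * g z) ∈ ball pN 𝓛 :=
      smul_mem_ball htr hpol (inv_nonneg.2 hbδ.le) (by rw [inv_mul_le_iff₀ hbδ]; linarith)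
    have h1 := abs_pairing_le_Tnorm hC F hmem
    rw [pairing_smul_right, abs_mul, abs_of_pos (inv_pos.2 hbδ), inv_mul_le_iff₀ hbδ] at h1
    linarith
  apply le_of_forall_pos_le_add
  intro ε hε
  rcases hT.eq_or_lt with hT' | hT'
  · have := key 1 one_pos
    rw [← hT'] at this ⊢
    linarith
  · have := key (ε / Tnorm pN 𝓛 F) (div_pos hε hT')
    rwa [mul_add, mul_div_cancel₀ _ hT'.ne'] at this

/-- **Product property of the `T`-seminorm** (Proposition 5.1.2 of [BS-rg-norm]):
`‖F ⋆ G‖_T ≤ ‖F‖_T ‖G‖_T`, for every family of test functionals with the shuffle property whose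
unit ball is bounded on short sequences. [cite: BrydgesSlade2015RGI, Proposition 5.1.2] -/
theorem Tnorm_star_le {pN : ℕ} {𝓛 : Set (TestFunctional Ξ)} {C : ℕ → ℝ}
    (hSH : ShuffleCompat pN 𝓛) (hC : EvalBound pN 𝓛 C) (F G : List Ξ → ℝ) :
    Tnorm pN 𝓛 (star F G) ≤ Tnorm pN 𝓛 F * Tnorm pN 𝓛 G :=
  Tnorm_le fun _ hg =>
    abs_pairing_star_le hSH (fun _ h => abs_pairing_le_Tnorm hC F h)
      (fun _ h => abs_pairing_le_Tnorm hC G h) hg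

end pairing

end Tphi

end LongRangePhi4

end Literature.Barriers.CriticalPhenomena

end
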